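import Mathlib.NumberTheory.Padics.Hensel
import Mathlib.NumberTheory.Padics.RingHoms
import Mathlib.RingTheory.Ideal.Norm.AbsNorm
import Mathlib.NumberTheory.NumberField.Basic
import Literature.NumberTheory.NumberFields.CubicFieldExplicit
import Summits.BirchSwinnertonDyer.BirchSwinnertonDyer.Theorems.Rank2Observatory2DescLinGens
import HarnessLib

/-!
# KERNEL-2DESC-CL, `p`-adic ROOT VIEW (part D3): three degree-one primes exhaust the primes above `p`

HONEST FRAMING: per-curve certified theorems and census instruments; no claim on BSD in rank ≥ 2.

For a cubic field `K` and a prime `p`: three pairwise distinct maximal ideals `P₁, P₂, P₃ ∋ p` of absolute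
norm `p` satisfy `(p) = P₁P₂P₃` (`span_eq_mul_three`: `P₁P₂P₃ ∣ (p)` by coprimality, and the cofactor
has norm `p³/p³ = 1`), hence every prime containing `p` is one of them (`eq_or_eq_or_eq_of_three`).  With
parts D1–D2 this is the complete local picture at a totally split `p` (the common-index-divisor fields at
`p = 2`), with no generator of `𝓞 K` and no factorisation of `f mod p` required. [folklore]
-/

noncomputable section

set_option linter.dupNamespace false

open NumberField Ideal

namespace Summit.BirchSwinnertonDyer.BirchSwinnertonDyer.Rank2Observatory.TwoDescPadic

section Cover

variable {K : Type*} [Field K] [NumberField K]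

/-- `N((p)) = p³` in a cubic field. [folklore] -/
theorem absNorm_span_natCast (h3 : Module.finrank ℚ K = 3) (p : ℕ) :
    absNorm (span {((p : ℕ) : 𝓞 K)}) = p ^ 3 := by
  rw [absNorm_span_singleton]
  have h : ((p : ℕ) : 𝓞 K) = algebraMap ℤ (𝓞 K) (p : ℤ) := by simp
  rw [h, Algebra.norm_algebraMap, RingOfIntegers.rank, h3]
  simp [Int.natAbs_pow]

omit [NumberField K] in
/-- Two distinct maximal ideals are coprime. [folklore] -/
theorem sup_eq_top_of_ne {P Q : Ideal (𝓞 K)} (hP : P.IsMaximal) (hQ : Q.IsMaximal) (h : P ≠ Q) :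
    P ⊔ Q = ⊤ :=
  hP.coprime_of_ne hQ h

/-- **`(p) = P₁P₂P₃`** for three pairwise distinct maximal ideals above `p` of norm `p` in a cubic field.
[folklore] -/
theorem span_eq_mul_three (h3 : Module.finrank ℚ K = 3) {p : ℕ} (hp : p.Prime)
    {P₁ P₂ P₃ : Ideal (𝓞 K)} (hM₁ : P₁.IsMaximal) (hM₂ : P₂.IsMaximal) (hM₃ : P₃.IsMaximal)
    (h12 : P₁ ≠ P₂) (h13 : P₁ ≠ P₃) (h23 : P₂ ≠ P₃)
    (hp₁ : ((p : ℕ) : 𝓞 K) ∈ P₁) (hp₂ : ((p : ℕ) : 𝓞 K) ∈ P₂) (hp₃ : ((p : ℕ) : 𝓞 K) ∈ P₃)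
    (hN₁ : absNorm P₁ = p) (hN₂ : absNorm P₂ = p) (hN₃ : absNorm P₃ = p) :
    span {((p : ℕ) : 𝓞 K)} = P₁ * P₂ * P₃ := by
  -- `(p) ≤ P₁ ⊓ P₂ ⊓ P₃ = P₁ P₂ P₃`
  have hle₁ : span {((p : ℕ) : 𝓞 K)} ≤ P₁ := by rw [span_le, Set.singleton_subset_iff]; exact hp₁
  have hle₂ : span {((p : ℕ) : 𝓞 K)} ≤ P₂ := by rw [span_le, Set.singleton_subset_iff]; exact hp₂
  have hle₃ : span {((p : ℕ) : 𝓞 K)} ≤ P₃ := by rw [span_le, Set.singleton_subset_iff]; exact hp₃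
  have hc12 : P₁ ⊔ P₂ = ⊤ := sup_eq_top_of_ne hM₁ hM₂ h12
  have hc : P₁ * P₂ ⊔ P₃ = ⊤ := by
    rw [Ideal.mul_sup_eq_of_coprime_left (sup_eq_top_of_ne hM₁ hM₃ h13)]
    exact sup_eq_top_of_ne hM₂ hM₃ h23
  have hinf : P₁ * P₂ * P₃ = P₁ ⊓ P₂ ⊓ P₃ := by
    rw [Ideal.mul_eq_inf_of_coprime hc, Ideal.mul_eq_inf_of_coprime hc12]
  have hle : span {((p : ℕ) : 𝓞 K)} ≤ P₁ * P₂ * P₃ := by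
    rw [hinf]; exact le_inf (le_inf hle₁ hle₂) hle₃
  obtain ⟨J, hJ⟩ := Ideal.dvd_iff_le.mpr hle
  -- norms: `p³ = p³ · N(J)`
  have hn := congrArg absNorm hJ
  rw [absNorm_span_natCast h3, map_mul, map_mul, map_mul, hN₁, hN₂, hN₃] at hn
  have hp3 : p ^ 3 ≠ 0 := pow_ne_zero 3 hp.ne_zero
  have hJ1 : absNorm J = 1 := by
    have : p ^ 3 * absNorm J = p ^ 3 * 1 := by rw [mul_one]; rw [pow_succ, pow_two]; linarith [hn]
    exact Nat.eq_of_mul_eq_mul_left (Nat.pos_of_ne_zero hp3) this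
  rw [absNorm_eq_one_iff] at hJ1
  rw [hJ, hJ1, Ideal.mul_top]

/-- **Every prime containing `p` is one of `P₁, P₂, P₃`.** [folklore] -/
theorem eq_or_eq_or_eq_of_three (h3 : Module.finrank ℚ K = 3) {p : ℕ} (hp : p.Prime)
    {P₁ P₂ P₃ : Ideal (𝓞 K)} (hM₁ : P₁.IsMaximal) (hM₂ : P₂.IsMaximal) (hM₃ : P₃.IsMaximal)
    (h12 : P₁ ≠ P₂) (h13 : P₁ ≠ P₃) (h23 : P₂ ≠ P₃)
    (hp₁ : ((p : ℕ) : 𝓞 K) ∈ P₁) (hp₂ : ((p : ℕ) : 𝓞 K) ∈ P₂) (hp₃ : ((p : ℕ) : 𝓞 K) ∈ P₃)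
    (hN₁ : absNorm P₁ = p) (hN₂ : absNorm P₂ = p) (hN₃ : absNorm P₃ = p)
    (P : Ideal (𝓞 K)) (hP : P.IsPrime) (hpP : ((p : ℕ) : 𝓞 K) ∈ P) :
    P = P₁ ∨ P = P₂ ∨ P = P₃ := by
  have hprod := span_eq_mul_three h3 hp hM₁ hM₂ hM₃ h12 h13 h23 hp₁ hp₂ hp₃ hN₁ hN₂ hN₃
  have hle : P₁ * P₂ * P₃ ≤ P := by
    rw [← hprod, span_le, Set.singleton_subset_iff]; exact hpP
  haveI := hP
  rcases (Ideal.IsPrime.mul_le hP).mp hle with h | h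
  · rcases (Ideal.IsPrime.mul_le hP).mp h with h | h
    · left; exact ((hM₁.eq_of_le hP.ne_top h)).symm
    · right; left; exact ((hM₂.eq_of_le hP.ne_top h)).symm
  · right; right; exact ((hM₃.eq_of_le hP.ne_top h)).symm

omit [NumberField K] in
/-- Distinctness from a separating element. [folklore] -/
theorem ne_of_mem_of_not_mem {P Q : Ideal (𝓞 K)} {x : 𝓞 K} (hx : x ∈ P) (hx' : x ∉ Q) : P ≠ Q := by
  rintro rfl; exact hx' hx

end Cover

end Summit.BirchSwinnertonDyer.BirchSwinnertonDyer.Rank2Observatory.TwoDescPadic
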